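import Mathlib
import HarnessLib

/-!
# Principal ideals and Green's relations in the full transformation monoid `𝒯(X)`

Source: O. Ganyushkin, V. Mazorchuk, *Classical Finite Transformation Semigroups*, Algebra and
Applications 9, Springer (2009) [GanyushkinMazorchuk2009], Chapter 4 "Ideals and Green's
relations": §4.2 (Theorems 4.2.1, 4.2.4, 4.2.8), §4.3 (Theorem 4.3.1 and the chain of ideals
displayed after it), §4.5 (Theorem 4.5.1, Corollary 4.5.2, Proposition 4.5.3), together with
Exercise 2.1.4 (b), (c) which the proofs quote — all in the case `S = 𝒯ₙ` of the full
transformation semigroup.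

We write the full transformation monoid `𝒯(X)` of a type `X` simply as the type of self-maps
`X → X` under composition; as in the book (§2.1, `(βα)(x) = β(α(x))`) the product `β α` is
`β ∘ α`.  The *image* of `α` is `Set.range α`, the *rank* of `α` (§1.1) is
`(Set.range α).ncard`, and the kernel relation `π_α` of (4.1) is `α x = α y`.  No new
definitions are introduced: every notion of the book is spelled out by its defining formula, so
that, e.g., "`β ∈ α𝒯(X)`" reads `∃ γ, β = α ∘ γ` and "`α 𝓛 β`" reads
`(∃ γ, β = γ ∘ α) ∧ (∃ δ, α = δ ∘ β)` (Propositions 4.4.1, 4.4.2).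

Main statements (for `α β : X → X`; `X` finite where ranks are compared):

* Theorem 4.2.1: `β ∈ α𝒯(X) ↔ im β ⊆ im α` (`exists_eq_comp_iff_range_subset`);
* Theorem 4.2.4: `β ∈ 𝒯(X)α ↔ π_α ⊆ π_β` (`exists_eq_comp_left_iff`; this is Mathlib's
  `Function.factorsThrough_iff` up to the empty type);
* Theorem 4.2.8: `β ∈ 𝒯(X)α𝒯(X) ↔ rank β ≤ rank α` (`exists_eq_comp_comp_iff_ncard_le`);
* Theorem 4.5.1 (i)–(v): the Green relations `𝓡, 𝓛, 𝓗, 𝓓, 𝓙` on `𝒯(X)` are "same image",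
  "same kernel", both, "same rank", "same rank" (`greenR_iff`, `greenL_iff`, `greenH_iff`,
  `greenD_iff`, `greenJ_iff`), and Corollary 4.5.2 `𝓓 = 𝓙` (`greenD_iff_greenJ`);
* Proposition 4.5.3: `α 𝓛 β ↔ α = μ ∘ β` for a permutation `μ` (`greenL_iff_exists_perm`);
* Theorem 4.3.1: every (nonempty) two-sided ideal of `𝒯(X)` is principal, generated by any
  element of maximal rank, equals `{β | rank β ≤ k}`, and the ideals form a chain
  (`ideal_eq_setOf_ncard_le`, `ideal_principal`, `ideals_chain`).

The partial (`𝒫𝒯ₙ`) and partial injective (`ℐ𝒮ₙ`) cases of the same theorems are not treated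
here.
-/

namespace Literature.Algebra.Semigroups.FullTransformation

open Function Set

variable {X : Type*}

/-! ### Exercise 2.1.4: image and rank of a product -/

/-- Exercise 2.1.4 (b): `im(βα) ⊆ im(β)`. [cite: GanyushkinMazorchuk2009, Exercise 2.1.4 (b)] -/
theorem range_comp_subset (β α : X → X) : range (β ∘ α) ⊆ range β :=
  range_comp_subset_range α β

/-- Exercise 2.1.4 (c), first half: `rank(βα) ≤ rank(β)` (for a finite set).
[cite: GanyushkinMazorchuk2009, Exercise 2.1.4 (c)] -/
theorem ncard_range_comp_le_left [Finite X] (β α : X → X) :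
    (range (β ∘ α)).ncard ≤ (range β).ncard :=
  ncard_le_ncard (range_comp_subset_range α β)

/-- Exercise 2.1.4 (c), second half: `rank(βα) ≤ rank(α)` (for a finite set), because
`im(βα) = β(im α)`. [cite: GanyushkinMazorchuk2009, Exercise 2.1.4 (c)] -/
theorem ncard_range_comp_le_right [Finite X] (β α : X → X) :
    (range (β ∘ α)).ncard ≤ (range α).ncard := by
  rw [range_comp]
  exact ncard_image_le

/-- Exercise 2.1.4 (c): `rank(βα) ≤ min(rank α, rank β)`.
[cite: GanyushkinMazorchuk2009, Exercise 2.1.4 (c)] -/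
theorem ncard_range_comp_le_min [Finite X] (β α : X → X) :
    (range (β ∘ α)).ncard ≤ min (range α).ncard (range β).ncard :=
  le_min (ncard_range_comp_le_right β α) (ncard_range_comp_le_left β α)

/-! ### §4.2: principal right, left and two-sided ideals -/

/-- **Theorem 4.2.1** (case `𝒯ₙ`): the principal right ideal `α𝒯(X)` generated by `α` is
`{β : im(β) ⊆ im(α)}`; i.e. `β = αγ` for some `γ` iff `im β ⊆ im α`.  The proof is the book's:
for each `x` choose `a` with `α(a) = β(x)` and let `γ(x) = a`.
[cite: GanyushkinMazorchuk2009, Theorem 4.2.1] -/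
theorem exists_eq_comp_iff_range_subset (α β : X → X) :
    (∃ γ : X → X, β = α ∘ γ) ↔ range β ⊆ range α := by
  constructor
  · rintro ⟨γ, rfl⟩
    exact range_comp_subset_range γ α
  · intro h
    have h' : ∀ x, ∃ a, α a = β x := fun x => h (mem_range_self x)
    choose γ hγ using h'
    exact ⟨γ, funext fun x => (hγ x).symm⟩

/-- **Theorem 4.2.4** (case `𝒯ₙ`): the principal left ideal `𝒯(X)α` is
`{β : π_α ⊆ π_β}`; i.e. `β = γα` for some `γ` iff `α(x) = α(y)` always implies `β(x) = β(y)`.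
(For maps `X → X` this is Mathlib's `Function.factorsThrough_iff`, the empty type being
trivial.) [cite: GanyushkinMazorchuk2009, Theorem 4.2.4] -/
theorem exists_eq_comp_left_iff (α β : X → X) :
    (∃ γ : X → X, β = γ ∘ α) ↔ ∀ ⦃x y : X⦄, α x = α y → β x = β y := by
  rcases isEmpty_or_nonempty X with hX | hX
  · exact ⟨fun _ x => isEmptyElim x, fun _ => ⟨β, funext fun x => isEmptyElim x⟩⟩
  · exact (factorsThrough_iff (f := α) β).symm

/-- **Theorem 4.2.8** (case `𝒯ₙ`, `X` finite): the principal two-sided ideal `𝒯(X)α𝒯(X)` is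
`{β : rank(β) ≤ rank(α)}`; i.e. `β = γαδ` for some `γ, δ` iff `|im β| ≤ |im α|`.  Proof as in
the book: choose an injection `b ↦ a_b` of `im β` into `im α`, let `δ` send `y` to a preimage
under `α` of `a_{β(y)}`, and let `γ` send `a_b` back to `b`.
[cite: GanyushkinMazorchuk2009, Theorem 4.2.8] -/
theorem exists_eq_comp_comp_iff_ncard_le [Finite X] (α β : X → X) :
    (∃ γ δ : X → X, β = γ ∘ α ∘ δ) ↔ (range β).ncard ≤ (range α).ncard := by
  constructor
  · rintro ⟨γ, δ, rfl⟩
    exact (ncard_range_comp_le_right γ (α ∘ δ)).trans (ncard_range_comp_le_left α δ)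
  · intro h
    classical
    haveI := Fintype.ofFinite (range β)
    haveI := Fintype.ofFinite (range α)
    have hcard : Fintype.card (range β) ≤ Fintype.card (range α) := by
      rwa [← Nat.card_eq_fintype_card, ← Nat.card_eq_fintype_card, Nat.card_coe_set_eq,
        Nat.card_coe_set_eq]
    obtain ⟨ι⟩ := Function.Embedding.nonempty_of_card_le hcard
    -- `δ y` is a preimage under `α` of `ι (β y)`.
    have hpre : ∀ y : X, ∃ c, α c = (ι ⟨β y, mem_range_self y⟩ : X) := fun y =>
      (ι ⟨β y, mem_range_self y⟩).2
    choose δ hδ using hpre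
    -- `γ` sends `ι b` back to `b` (and is arbitrary elsewhere).
    let j : range β → X := fun b => (ι b : X)
    have hj : Injective j := Subtype.val_injective.comp ι.injective
    refine ⟨Function.extend j (fun b => (b : X)) id, δ, funext fun y => ?_⟩
    simp only [comp_apply, hδ y]
    exact (hj.extend_apply (fun b : range β => (b : X)) id ⟨β y, mem_range_self y⟩).symm

/-! ### §4.5: Green's relations on `𝒯(X)`

Following Propositions 4.4.1 and 4.4.2, `α 𝓛 β` means `α = xβ ∧ β = yα` for some `x, y`, and
`α 𝓡 β` means `α = βx ∧ β = αy`; `𝓗 = 𝓡 ∩ 𝓛`; `α 𝓙 β` means that each of `α, β` lies in the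
principal two-sided ideal of the other; and `𝓓 = 𝓛 ∘ 𝓡`, i.e. `α 𝓓 β` iff `α 𝓛 γ` and
`γ 𝓡 β` for some `γ` (§4.4, after Exercise 4.4.5). -/

/-- **Theorem 4.5.1 (i)** (case `𝒯ₙ`): `α 𝓡 β` iff `im(α) = im(β)`.
[cite: GanyushkinMazorchuk2009, Theorem 4.5.1 (i)] -/
theorem greenR_iff (α β : X → X) :
    ((∃ x : X → X, α = β ∘ x) ∧ ∃ y : X → X, β = α ∘ y) ↔ range α = range β := by
  rw [exists_eq_comp_iff_range_subset, exists_eq_comp_iff_range_subset, Subset.antisymm_iff]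

/-- **Theorem 4.5.1 (ii)** (case `𝒯ₙ`): `α 𝓛 β` iff `ρ_α = ρ_β`, i.e. the kernel partitions
coincide: `α(x) = α(y) ↔ β(x) = β(y)` for all `x, y`.
[cite: GanyushkinMazorchuk2009, Theorem 4.5.1 (ii)] -/
theorem greenL_iff (α β : X → X) :
    ((∃ x : X → X, α = x ∘ β) ∧ ∃ y : X → X, β = y ∘ α) ↔ ∀ x y : X, α x = α y ↔ β x = β y := by
  rw [exists_eq_comp_left_iff, exists_eq_comp_left_iff]
  exact ⟨fun h x y => ⟨fun hxy => h.2 hxy, fun hxy => h.1 hxy⟩,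
    fun h => ⟨fun x y hxy => (h x y).2 hxy, fun x y hxy => (h x y).1 hxy⟩⟩

/-- **Theorem 4.5.1 (iii)** (case `𝒯ₙ`): `α 𝓗 β` iff `im(α) = im(β)` and `ρ_α = ρ_β`.
[cite: GanyushkinMazorchuk2009, Theorem 4.5.1 (iii)] -/
theorem greenH_iff (α β : X → X) :
    (((∃ x : X → X, α = β ∘ x) ∧ ∃ y : X → X, β = α ∘ y) ∧
      ((∃ x : X → X, α = x ∘ β) ∧ ∃ y : X → X, β = y ∘ α)) ↔
      range α = range β ∧ ∀ x y : X, α x = α y ↔ β x = β y := by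
  rw [greenR_iff, greenL_iff]

/-- **Theorem 4.5.1 (v)** (case `𝒯ₙ`, `X` finite): `α 𝓙 β` iff `rank(α) = rank(β)`.
[cite: GanyushkinMazorchuk2009, Theorem 4.5.1 (v)] -/
theorem greenJ_iff [Finite X] (α β : X → X) :
    ((∃ x y : X → X, α = x ∘ β ∘ y) ∧ ∃ x y : X → X, β = x ∘ α ∘ y) ↔
      (range α).ncard = (range β).ncard := by
  rw [exists_eq_comp_comp_iff_ncard_le, exists_eq_comp_comp_iff_ncard_le]
  exact ⟨fun h => le_antisymm h.1 h.2, fun h => ⟨h.le, h.ge⟩⟩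

/-- An `𝓛`-related pair has the same rank (used in Theorem 4.5.1 (iv)).
[cite: GanyushkinMazorchuk2009, Theorem 4.5.1] -/
theorem ncard_range_eq_of_greenL [Finite X] {α β : X → X}
    (h : (∃ x : X → X, α = x ∘ β) ∧ ∃ y : X → X, β = y ∘ α) :
    (range α).ncard = (range β).ncard := by
  obtain ⟨⟨x, hx⟩, ⟨y, hy⟩⟩ := h
  refine le_antisymm ?_ ?_
  · rw [hx]; exact ncard_range_comp_le_right x β
  · rw [hy]; exact ncard_range_comp_le_right y α

/-- An `𝓡`-related pair has the same image, hence the same rank (used in Theorem 4.5.1 (iv)).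
[cite: GanyushkinMazorchuk2009, Theorem 4.5.1] -/
theorem ncard_range_eq_of_greenR {α β : X → X}
    (h : (∃ x : X → X, α = β ∘ x) ∧ ∃ y : X → X, β = α ∘ y) :
    (range α).ncard = (range β).ncard := by
  rw [(greenR_iff α β).1 h]

/-- **Theorem 4.5.1 (iv)** (case `𝒯ₙ`, `X` finite): `α 𝓓 β` iff `rank(α) = rank(β)`.  Here
`𝓓 = 𝓛 ∘ 𝓡`: `α 𝓓 β` iff there is `γ` with `α 𝓛 γ` and `γ 𝓡 β`.  The witness `γ` in the
backward direction is the book's: `γ(x) = b_j` iff `α(x) = a_j`, for a bijection `a_j ↦ b_j`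
between `im α` and `im β`. [cite: GanyushkinMazorchuk2009, Theorem 4.5.1 (iv)] -/
theorem greenD_iff [Finite X] (α β : X → X) :
    (∃ γ : X → X, ((∃ x : X → X, α = x ∘ γ) ∧ ∃ y : X → X, γ = y ∘ α) ∧
        ((∃ x : X → X, γ = β ∘ x) ∧ ∃ y : X → X, β = γ ∘ y)) ↔
      (range α).ncard = (range β).ncard := by
  constructor
  · rintro ⟨γ, hL, hR⟩
    exact (ncard_range_eq_of_greenL hL).trans (ncard_range_eq_of_greenR hR)
  · intro h
    have hcard : Nat.card (range α) = Nat.card (range β) := by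
      rwa [Nat.card_coe_set_eq, Nat.card_coe_set_eq]
    obtain ⟨e⟩ := Finite.card_eq.1 hcard
    refine ⟨fun x => (e ⟨α x, mem_range_self x⟩ : X), ?_, ?_⟩
    · rw [greenL_iff]
      intro x y
      constructor
      · intro hxy
        have : (⟨α x, mem_range_self x⟩ : range α) = ⟨α y, mem_range_self y⟩ := Subtype.ext hxy
        rw [this]
      · intro hxy
        have := e.injective (Subtype.val_injective hxy)
        exact congrArg Subtype.val this
    · rw [greenR_iff]
      ext z
      constructor
      · rintro ⟨x, rfl⟩
        exact (e ⟨α x, mem_range_self x⟩).2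
      · rintro ⟨y, rfl⟩
        obtain ⟨x, hx⟩ := (e.symm ⟨β y, mem_range_self y⟩).2
        refine ⟨x, ?_⟩
        have : (⟨α x, mem_range_self x⟩ : range α) = e.symm ⟨β y, mem_range_self y⟩ :=
          Subtype.ext hx
        simp only [this, Equiv.apply_symm_apply]

/-- **Corollary 4.5.2** (case `𝒯ₙ`, `X` finite): on `𝒯(X)` the relations `𝓓` and `𝓙`
coincide. [cite: GanyushkinMazorchuk2009, Corollary 4.5.2] -/
theorem greenD_iff_greenJ [Finite X] (α β : X → X) :
    (∃ γ : X → X, ((∃ x : X → X, α = x ∘ γ) ∧ ∃ y : X → X, γ = y ∘ α) ∧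
        ((∃ x : X → X, γ = β ∘ x) ∧ ∃ y : X → X, β = γ ∘ y)) ↔
      ((∃ x y : X → X, α = x ∘ β ∘ y) ∧ ∃ x y : X → X, β = x ∘ α ∘ y) := by
  rw [greenD_iff, greenJ_iff]

/-- **Proposition 4.5.3** (case `𝒯ₙ`, `X` finite): `α 𝓛 β` iff `α = μβ` for some permutation
`μ ∈ 𝒮(X)`.  Proof as printed: on the blocks `A_i` of the common kernel partition, with
`α = a_i` and `β = b_i` on `A_i`, take any permutation with `μ(b_i) = a_i` (here: the bijection
`im β → im α`, `b_i ↦ a_i`, extended to a permutation of the finite set `X`).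
[cite: GanyushkinMazorchuk2009, Proposition 4.5.3] -/
theorem greenL_iff_exists_perm [Finite X] (α β : X → X) :
    ((∃ x : X → X, α = x ∘ β) ∧ ∃ y : X → X, β = y ∘ α) ↔ ∃ μ : Equiv.Perm X, α = μ ∘ β := by
  constructor
  · intro h
    rw [greenL_iff] at h
    classical
    -- the bijection `im β → im α`, `β(x) ↦ α(x)`
    have hrep : ∀ b : range β, ∃ x, β x = b := fun b => b.2
    choose rep hrep using hrep
    let g : range β → range α := fun b => ⟨α (rep b), mem_range_self _⟩
    have hg_apply : ∀ x : X, (g ⟨β x, mem_range_self x⟩ : X) = α x := by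
      intro x
      simp only [g]
      exact (h _ _).2 (hrep ⟨β x, mem_range_self x⟩)
    have hg : Bijective g := by
      constructor
      · intro b b' hbb'
        have h1 : α (rep b) = α (rep b') := congrArg Subtype.val hbb'
        have h2 : β (rep b) = β (rep b') := (h _ _).1 h1
        exact Subtype.ext (by rw [← hrep b, ← hrep b', h2])
      · rintro ⟨a, x, rfl⟩
        exact ⟨⟨β x, mem_range_self x⟩, Subtype.ext (hg_apply x)⟩
    let e : range β ≃ range α := Equiv.ofBijective g hg
    refine ⟨e.extendSubtype, funext fun x => ?_⟩
    simp only [comp_apply]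
    rw [e.extendSubtype_apply_of_mem _ (mem_range_self x)]
    exact (hg_apply x).symm
  · rintro ⟨μ, hμ⟩
    refine ⟨⟨μ, hμ⟩, ⟨⇑μ.symm, ?_⟩⟩
    rw [hμ]
    funext x
    simp

/-! ### §4.3: all two-sided ideals of `𝒯(X)` -/

/-- The sets `𝓘_k = {α : rank(α) ≤ k}` are two-sided ideals of `𝒯(X)` (the family displayed
after Theorem 4.3.1). [cite: GanyushkinMazorchuk2009, Theorem 4.3.1] -/
theorem comp_comp_mem_setOf_ncard_le [Finite X] (k : ℕ) {β : X → X}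
    (hβ : β ∈ {α : X → X | (range α).ncard ≤ k}) (γ δ : X → X) :
    γ ∘ β ∘ δ ∈ {α : X → X | (range α).ncard ≤ k} :=
  ((exists_eq_comp_comp_iff_ncard_le β _).1 ⟨γ, δ, rfl⟩).trans hβ

/-- **Theorem 4.3.1** (case `𝒯ₙ`, `X` finite): a nonempty two-sided ideal `I` of `𝒯(X)`
contains an element `α` of maximal rank, and then `I = {β : rank(β) ≤ rank(α)}`.
[cite: GanyushkinMazorchuk2009, Theorem 4.3.1] -/
theorem ideal_eq_setOf_ncard_le [Finite X] {I : Set (X → X)} (hne : I.Nonempty)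
    (hI : ∀ β ∈ I, ∀ γ δ : X → X, γ ∘ β ∘ δ ∈ I) :
    ∃ α ∈ I, (∀ β ∈ I, (range β).ncard ≤ (range α).ncard) ∧
      I = {β : X → X | (range β).ncard ≤ (range α).ncard} := by
  obtain ⟨α, hα, hmax⟩ := exists_max_image I (fun β : X → X => (range β).ncard) I.toFinite hne
  refine ⟨α, hα, hmax, Subset.antisymm (fun β hβ => hmax β hβ) fun β hβ => ?_⟩
  obtain ⟨γ, δ, rfl⟩ := (exists_eq_comp_comp_iff_ncard_le α β).2 hβ
  exact hI α hα γ δ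

/-- **Theorem 4.3.1** (case `𝒯ₙ`, `X` finite): all two-sided ideals of `𝒯(X)` are principal,
generated by any element of the ideal of maximal rank.
[cite: GanyushkinMazorchuk2009, Theorem 4.3.1] -/
theorem ideal_principal [Finite X] {I : Set (X → X)}
    (hI : ∀ β ∈ I, ∀ γ δ : X → X, γ ∘ β ∘ δ ∈ I) {α : X → X} (hα : α ∈ I)
    (hmax : ∀ β ∈ I, (range β).ncard ≤ (range α).ncard) :
    I = {β : X → X | ∃ γ δ : X → X, β = γ ∘ α ∘ δ} := by
  refine Subset.antisymm (fun β hβ => ?_) ?_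
  · exact (exists_eq_comp_comp_iff_ncard_le α β).2 (hmax β hβ)
  · rintro β ⟨γ, δ, rfl⟩
    exact hI α hα γ δ

/-- After Theorem 4.3.1: the two-sided ideals of `𝒯(X)` form a chain under inclusion.
[cite: GanyushkinMazorchuk2009, Theorem 4.3.1] -/
theorem ideals_chain [Finite X] {I J : Set (X → X)} (hIne : I.Nonempty)
    (hI : ∀ β ∈ I, ∀ γ δ : X → X, γ ∘ β ∘ δ ∈ I) (hJne : J.Nonempty)
    (hJ : ∀ β ∈ J, ∀ γ δ : X → X, γ ∘ β ∘ δ ∈ J) : I ⊆ J ∨ J ⊆ I := by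
  obtain ⟨α, -, -, rfl⟩ := ideal_eq_setOf_ncard_le hIne hI
  obtain ⟨α', -, -, rfl⟩ := ideal_eq_setOf_ncard_le hJne hJ
  rcases le_total (range α).ncard (range α').ncard with h | h
  · exact Or.inl fun β hβ => le_trans (by exact hβ) h
  · exact Or.inr fun β hβ => le_trans (by exact hβ) h

end Literature.Algebra.Semigroups.FullTransformation
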